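import Literature.AlgebraicGeometry.Motives.FamiliesVHSHom
import HarnessLib

/-!
# Morphisms of the data of polarized variations of Hodge structure: flat families of lattice maps that are fibrewise morphisms of Hodge
# structures; they preserve integral Hodge classes and Hodge loci, and are exactly the flat global Hodge classes of `Hom(D₁, D₂)`

Topic `Literature/AlgebraicGeometry/Motives` (namespace `Literature.AlgebraicGeometry.Motives.VHSData`), lane `lit-hodgefound` (seat `p08`, row g56-#15).
DEFINITIONS WITH BODIES (the structure `VHSData.Hom`, `Hom.app`, `Hom.appRat`, `Hom.hodgeHom`, `Hom.id`, `Hom.comp`, `Hom.ofFlat`) and their API; no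
named fact, no instance, no notation (D-0026 net debt `0`).  Built on `Motives/FamiliesVHSHom` (`homRat`, `homClass`, `isHodgeAt_homClass_iff`).

PRINTED SOURCES.  P. Deligne, *Équations différentielles à points singuliers réguliers*, LNM 163 (1970), I.1: a morphism of local systems is a natural
transformation of the functors on the fundamental groupoid (equivalently a flat family of maps of fibres).  W. Schmid, *Variation of Hodge structure*,
Invent. Math. 22 (1973), §2 ∕ P. Griffiths, *Periods of integrals III*, §1 ∕ C. Voisin, *Hodge Theory I*, §7.3.1 (with Lemma 7.25) and II, §5.3: a
morphism of variations of Hodge structure is a flat map of the underlying local systems which is a morphism of Hodge structures on each fibre; the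
image of a Hodge class is a Hodge class (so Hodge loci are functorial), and the flat global sections of `Hom(𝒱₁, 𝒱₂)` of type `(0,0)` everywhere
are the morphisms `𝒱₁ → 𝒱₂`.  P. Deligne, *Théorie de Hodge II*, 1.1.6 ∕ 2.1 (morphisms of Hodge structures, `Hom`).

* §1 **`structure VHSData.Hom D₁ D₂`** (same weight): a morphism `fZ : V₁,ℤ ⟶ V₂,ℤ` of integral local systems (a natural transformation on `Π₁(S)` —
  flatness is built in) whose rationalization at every point is a morphism of Hodge structures (`map_F_le`, through `homRat`).  API: `app s` (the lattice
  map at `s`), `app_transport` (flatness), `appRat s` (its rationalization) with `appRat_toRat`, `hodgeHom s : HodgeStructure.Hom (H₁,s) (H₂,s)`,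
  `Hom.id`, `Hom.comp`, and the constructor **`Hom.ofFlat`** from a flat family of lattice maps Hodge everywhere.
* §2 **Morphisms preserve Hodge classes and Hodge loci**: `Hom.isHodgeAt_app` (`u` Hodge of level `p` at `s` ⟹ `φ_s u` Hodge of level `p`),
  `Hom.isHodgeAt_transport_app` (determinations: `φ_t(γ_* u) = γ_*(φ_s u)`).
* §3 **Morphisms are the flat global Hodge classes of `Hom(D₁, D₂)`**: `Hom.transport_homClass_app` (the classes `homClass (φ_s)` form a flat family:
  `γ_* homClass(φ_s) = homClass(φ_t)`) and `Hom.isHodgeAt_homClass_app` (each is an integral Hodge class of level `0`); conversely `Hom.ofFlat`.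

* §4 **Rigidity**: `homClass_app_mem_flatSections` (`s ↦ homClass(φ_s)` is a flat global section of `Hom(V₁,ℤ, V₂,ℤ)`), `app_eq_of_app_eq` (two morphisms
  agreeing at `s` agree at every `t` joined to `s`), `ext_of_app`, `ext_of_app_eq` (over a path-connected base a morphism is determined by its value at one point).

HONEST SCOPE: morphisms need not respect the polarizations (as in the literature); only equal weights; holomorphy is automatic analytically for flat maps
but, as everywhere for `VHSData`, not recorded.

## References

* [Deligne1970] P. Deligne, *Équations différentielles à points singuliers réguliers*, LNM 163 (1970), I.1.
* [Schmid1973] W. Schmid, *Variation of Hodge structure: the singularities of the period mapping*, Invent. Math. 22 (1973), §2.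
* [Griffiths1970] P. Griffiths, *Periods of integrals on algebraic manifolds III*, Publ. Math. IHÉS 38 (1970), §1.
* [VoisinHodgeI2002] C. Voisin, *Hodge Theory and Complex Algebraic Geometry I* (CUP, 2002), §7.3.1, Lemma 7.25.
* [DeligneHodgeII1971] P. Deligne, *Théorie de Hodge II*, Publ. Math. IHÉS 40 (1971), 1.1.6, 2.1.
* [CattaniDeligneKaplan1995] E. Cattani, P. Deligne, A. Kaplan, *On the locus of Hodge classes*, J. Amer. Math. Soc. 8 (1995), §1.
-/

noncomputable section

open CategoryTheory
open scoped TensorProduct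

namespace Literature.AlgebraicGeometry.Motives

namespace VHSData

variable {S : Type} [TopologicalSpace S] {k : ℤ} {D₁ D₂ D₃ : VHSData S k}

/-! ## §1 Morphisms of VHS data -/

/-- **A morphism of the data of two polarized variations of Hodge structure of the same weight** (Schmid 1973 §2 ∕ Voisin I §7.3.1): a morphism
`fZ : V₁,ℤ → V₂,ℤ` of the integral local systems — a natural transformation of functors on `Π₁(S)`, i.e. a FLAT family of lattice maps — whose
rationalization at every point `s` is a morphism of Hodge structures `(V₁,s, F) → (V₂,s, F)` (`(φ_s)_ℚ,ℂ (F^p) ⊆ F^p`).  Compatibility with the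
polarizations is not required. [cite: Schmid1973, §2] [cite: VoisinHodgeI2002, §7.3.1] [cite: Deligne1970, I.1] -/
structure Hom (D₁ D₂ : VHSData S k) where
  /-- The morphism of integral local systems (natural in the point of `Π₁(S)`). -/
  fZ : D₁.VZ ⟶ D₂.VZ
  /-- At every point the rationalization respects the Hodge filtrations. -/
  map_F_le : ∀ (s : S) (p : ℤ), ((D₁.hodge s).F p).map ((D₁.homRat D₂ s (fZ.app ⟨s⟩).hom).baseChange ℂ) ≤ (D₂.hodge s).F p

namespace Hom

/-- The lattice map `φ_s : V₁,ℤ,s → V₂,ℤ,s` of a morphism at `s`. [cite: Schmid1973, §2] -/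
def app (φ : Hom D₁ D₂) (s : S) : D₁.VZ.fiber s →ₗ[ℤ] D₂.VZ.fiber s :=
  (φ.fZ.app ⟨s⟩).hom

/-- `app` unfolded. [cite: Schmid1973, §2] -/
theorem app_def (φ : Hom D₁ D₂) (s : S) : φ.app s = (φ.fZ.app ⟨s⟩).hom := rfl

/-- **Flatness**: `φ_t (γ_* u) = γ_* (φ_s u)` (naturality of `fZ` on the fundamental groupoid). [cite: Deligne1970, I.1] [cite: Schmid1973, §2] -/
theorem app_transport (φ : Hom D₁ D₂) {s t : S} (γ : Path.Homotopic.Quotient s t) (u : D₁.VZ.fiber s) :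
    φ.app t (D₁.VZ.transport γ u) = D₂.VZ.transport γ (φ.app s u) := by
  have h := congrArg (fun f => f.hom u) (φ.fZ.naturality (FundamentalGroupoid.fromPath γ))
  simp only [ModuleCat.hom_comp, LinearMap.comp_apply] at h
  exact h

/-- Flatness as an identity of linear maps: `φ_t ∘ γ_* = γ_* ∘ φ_s`. [cite: Deligne1970, I.1] -/
theorem app_comp_transport (φ : Hom D₁ D₂) {s t : S} (γ : Path.Homotopic.Quotient s t) :
    φ.app t ∘ₗ D₁.VZ.transport γ = D₂.VZ.transport γ ∘ₗ φ.app s :=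
  LinearMap.ext fun u => φ.app_transport γ u

/-- Flatness, conjugation form: `γ_* ∘ φ_s ∘ γ⁻¹_* = φ_t`. [cite: Deligne1970, I.1] -/
theorem transport_comp_app_comp_transport_symm (φ : Hom D₁ D₂) {s t : S} (γ : Path.Homotopic.Quotient s t) :
    D₂.VZ.transport γ ∘ₗ φ.app s ∘ₗ D₁.VZ.transport γ.symm = φ.app t := by
  refine LinearMap.ext fun u => ?_
  simp only [LinearMap.comp_apply]
  rw [← φ.app_transport, D₁.VZ.transport_apply_transport_symm]

/-- The rationalization `(φ_s)_ℚ : V₁,s → V₂,s` of a morphism at `s`. [cite: Schmid1973, §2] -/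
def appRat (φ : Hom D₁ D₂) (s : S) : D₁.V.fiber s →ₗ[ℚ] D₂.V.fiber s :=
  D₁.homRat D₂ s (φ.app s)

/-- `(φ_s)_ℚ (toRat m) = toRat (φ_s m)`. [cite: Schmid1973, §2] -/
theorem appRat_toRat (φ : Hom D₁ D₂) (s : S) (m : D₁.VZ.fiber s) : φ.appRat s (D₁.toRat s m) = D₂.toRat s (φ.app s m) :=
  D₁.homRat_toRat D₂ s (φ.app s) m

/-- **The morphism of Hodge structures `(V₁,s, F) → (V₂,s, F)` at `s`** underlying a morphism of VHS data. [cite: VoisinHodgeI2002, §7.3.1] [cite: DeligneHodgeII1971, 2.1] -/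
def hodgeHom (φ : Hom D₁ D₂) (s : S) : HodgeStructure.Hom (D₁.hodge s) (D₂.hodge s) where
  toLinearMap := φ.appRat s
  map_F_le := φ.map_F_le s

/-- The underlying map of `hodgeHom` is the rationalization. [cite: VoisinHodgeI2002, §7.3.1] -/
@[simp] theorem hodgeHom_toLinearMap (φ : Hom D₁ D₂) (s : S) : (φ.hodgeHom s).toLinearMap = φ.appRat s := rfl

/-- **The identity morphism.** [cite: Schmid1973, §2] -/
def id (D : VHSData S k) : Hom D D where
  fZ := 𝟙 D.VZ
  map_F_le s p := by
    rw [NatTrans.id_app, ModuleCat.hom_id, homRat_id, LinearMap.baseChange_id, Submodule.map_id]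

/-- The identity at `s` is the identity. [cite: Schmid1973, §2] -/
@[simp] theorem id_app (D : VHSData S k) (s : S) : (Hom.id D).app s = LinearMap.id := rfl

/-- **Composition of morphisms.** [cite: Schmid1973, §2] -/
def comp (ψ : Hom D₂ D₃) (φ : Hom D₁ D₂) : Hom D₁ D₃ where
  fZ := φ.fZ ≫ ψ.fZ
  map_F_le s p := by
    rw [NatTrans.comp_app, ModuleCat.hom_comp, homRat_comp, LinearMap.baseChange_comp, Submodule.map_comp]
    exact (Submodule.map_mono (φ.map_F_le s p)).trans (ψ.map_F_le s p)

/-- Composition at `s` is composition. [cite: Schmid1973, §2] -/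
@[simp] theorem comp_app (ψ : Hom D₂ D₃) (φ : Hom D₁ D₂) (s : S) : (ψ.comp φ).app s = ψ.app s ∘ₗ φ.app s := rfl

/-- **A flat family of lattice maps which is Hodge everywhere is a morphism** (Voisin I §7.3.1; the converse of §3): given `f_s : V₁,ℤ,s → V₂,ℤ,s` for all
`s` with `f_t ∘ γ_* = γ_* ∘ f_s` for every path class and `(f_s)_ℚ` a morphism of Hodge structures at every `s`. [cite: VoisinHodgeI2002, §7.3.1]
[cite: Deligne1970, I.1] -/
def ofFlat (f : ∀ s : S, D₁.VZ.fiber s →ₗ[ℤ] D₂.VZ.fiber s)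
    (hflat : ∀ {s t : S} (γ : Path.Homotopic.Quotient s t) (u : D₁.VZ.fiber s), f t (D₁.VZ.transport γ u) = D₂.VZ.transport γ (f s u))
    (hF : ∀ (s : S) (p : ℤ), ((D₁.hodge s).F p).map ((D₁.homRat D₂ s (f s)).baseChange ℂ) ≤ (D₂.hodge s).F p) : Hom D₁ D₂ where
  fZ :=
    { app := fun x => ModuleCat.ofHom (f x.as)
      naturality := fun x y g => by
        ext u
        exact hflat g u }
  map_F_le := hF

/-- The morphism built by `ofFlat` has the prescribed lattice maps. [cite: VoisinHodgeI2002, §7.3.1] -/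
@[simp] theorem ofFlat_app (f : ∀ s : S, D₁.VZ.fiber s →ₗ[ℤ] D₂.VZ.fiber s)
    (hflat : ∀ {s t : S} (γ : Path.Homotopic.Quotient s t) (u : D₁.VZ.fiber s), f t (D₁.VZ.transport γ u) = D₂.VZ.transport γ (f s u))
    (hF : ∀ (s : S) (p : ℤ), ((D₁.hodge s).F p).map ((D₁.homRat D₂ s (f s)).baseChange ℂ) ≤ (D₂.hodge s).F p) (s : S) :
    (ofFlat f hflat hF).app s = f s := rfl

/-! ## §2 Morphisms preserve integral Hodge classes (functoriality of Hodge loci) -/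

/-- **The image of an integral Hodge class under a morphism is an integral Hodge class of the same level** (Voisin II §5.3: Hodge loci are
functorial): `u ∈ V₁,ℤ,s` Hodge of level `p` ⟹ `φ_s u ∈ V₂,ℤ,s` Hodge of level `p`. [cite: VoisinHodgeI2002, §7.3.1 and Lemma 7.25] [cite: CattaniDeligneKaplan1995, §1] -/
theorem isHodgeAt_app (φ : Hom D₁ D₂) {s : S} {p : ℤ} {u : D₁.VZ.fiber s} (hu : D₁.IsHodgeAt s p u) : D₂.IsHodgeAt s p (φ.app s u) := by
  have h := (φ.hodgeHom s).apply_mem_hodgeClasses hu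
  rw [hodgeHom_toLinearMap, appRat_toRat] at h
  exact h

/-- **Determinations are functorial**: if the determination `γ_* u` of `u` at `t` is Hodge of level `p` for `D₁`, the determination `γ_* (φ_s u)` of
`φ_s u` at `t` is Hodge of level `p` for `D₂` — so the determination ∕ Hodge loci of `u` are contained in those of `φ_s u`.
[cite: CattaniDeligneKaplan1995, §1] [cite: VoisinHodgeI2002, §7.3.1] -/
theorem isHodgeAt_transport_app (φ : Hom D₁ D₂) {s t : S} (γ : Path.Homotopic.Quotient s t) {p : ℤ} {u : D₁.VZ.fiber s}
    (hu : D₁.IsHodgeAt t p (D₁.VZ.transport γ u)) : D₂.IsHodgeAt t p (D₂.VZ.transport γ (φ.app s u)) := by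
  rw [← φ.app_transport]
  exact φ.isHodgeAt_app hu

/-- The determination locus of `u` is contained in that of `φ_s u`. [cite: CattaniDeligneKaplan1995, §1, Cor. 1.3] -/
theorem setOf_exists_isHodgeAt_transport_subset (φ : Hom D₁ D₂) (s : S) (p : ℤ) (u : D₁.VZ.fiber s) :
    {t : S | ∃ γ : Path.Homotopic.Quotient s t, D₁.IsHodgeAt t p (D₁.VZ.transport γ u)} ⊆
      {t : S | ∃ γ : Path.Homotopic.Quotient s t, D₂.IsHodgeAt t p (D₂.VZ.transport γ (φ.app s u))} :=
  fun _ ⟨γ, hγ⟩ => ⟨γ, φ.isHodgeAt_transport_app γ hγ⟩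

/-! ## §3 Morphisms are the flat global Hodge classes of `Hom(D₁, D₂)` -/

/-- **The classes `homClass (φ_s)` of a morphism form a FLAT family in `Hom(D₁, D₂)`**: `γ_* homClass(φ_s) = homClass(φ_t)` (transport in `Hom` is
conjugation, `hom_VZ_transport_homClass`, and `γ_* φ_s γ_*⁻¹ = φ_t` by flatness). [cite: Deligne1970, I.1] [cite: VoisinHodgeI2002, §7.3.1] -/
theorem transport_homClass_app (φ : Hom D₁ D₂) {s t : S} (γ : Path.Homotopic.Quotient s t) :
    (D₁.hom D₂).VZ.transport γ (D₁.homClass D₂ s (φ.app s)) = D₁.homClass D₂ t (φ.app t) := by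
  rw [hom_VZ_transport_homClass, transport_comp_app_comp_transport_symm]

/-- **Each `homClass (φ_s)` is an integral Hodge class of level `0` of `Hom(D₁, D₂)`** (`(φ_s)_ℚ` is a morphism of Hodge structures;
`isHodgeAt_homClass_of_hom`). [cite: DeligneHodgeII1971, 1.1.6 and 2.1] [cite: VoisinHodgeI2002, Lemma 7.25] -/
theorem isHodgeAt_homClass_app (φ : Hom D₁ D₂) (s : S) : (D₁.hom D₂).IsHodgeAt s 0 (D₁.homClass D₂ s (φ.app s)) :=
  D₁.isHodgeAt_homClass_of_hom D₂ s (φ.app s) (φ.hodgeHom s) rfl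

/-- Hence every determination of `homClass (φ_s)` is Hodge: the morphism locus of `φ_s` contains every point joined to `s`.
[cite: CattaniDeligneKaplan1995, §1] [cite: VoisinHodgeI2002, §7.3.1] -/
theorem isHodgeAt_transport_homClass_app (φ : Hom D₁ D₂) {s t : S} (γ : Path.Homotopic.Quotient s t) :
    (D₁.hom D₂).IsHodgeAt t 0 ((D₁.hom D₂).VZ.transport γ (D₁.homClass D₂ s (φ.app s))) := by
  rw [transport_homClass_app]
  exact φ.isHodgeAt_homClass_app t

/-- **Conversely, a flat family of lattice maps all of whose classes are integral Hodge classes of `Hom(D₁, D₂)` is a morphism** (`Hom.ofFlat` with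
`isHodgeAt_homClass_iff`). [cite: VoisinHodgeI2002, §7.3.1 and Lemma 7.25] [cite: DeligneHodgeII1971, 1.1.6 and 2.1] -/
def ofFlatOfIsHodgeAt (f : ∀ s : S, D₁.VZ.fiber s →ₗ[ℤ] D₂.VZ.fiber s)
    (hflat : ∀ {s t : S} (γ : Path.Homotopic.Quotient s t) (u : D₁.VZ.fiber s), f t (D₁.VZ.transport γ u) = D₂.VZ.transport γ (f s u))
    (hH : ∀ s : S, (D₁.hom D₂).IsHodgeAt s 0 (D₁.homClass D₂ s (f s))) : Hom D₁ D₂ :=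
  ofFlat f hflat fun s => (D₁.isHodgeAt_homClass_iff D₂ s (f s)).1 (hH s)

/-- The morphism built by `ofFlatOfIsHodgeAt` has the prescribed lattice maps. [cite: VoisinHodgeI2002, §7.3.1] -/
@[simp] theorem ofFlatOfIsHodgeAt_app (f : ∀ s : S, D₁.VZ.fiber s →ₗ[ℤ] D₂.VZ.fiber s)
    (hflat : ∀ {s t : S} (γ : Path.Homotopic.Quotient s t) (u : D₁.VZ.fiber s), f t (D₁.VZ.transport γ u) = D₂.VZ.transport γ (f s u))
    (hH : ∀ s : S, (D₁.hom D₂).IsHodgeAt s 0 (D₁.homClass D₂ s (f s))) (s : S) : (ofFlatOfIsHodgeAt f hflat hH).app s = f s := rfl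

end Hom


/-! ## §4 A morphism is a flat global section of `Hom(D₁, D₂)`; it is determined on each path component by its value at one point -/

namespace Hom

/-- **The classes `s ↦ homClass (φ_s)` form a flat global section of the local system `Hom(V₁,ℤ, V₂,ℤ)`** (the tree's `LocalSystem.flatSections`).
[cite: Deligne1970, I.1] [cite: VoisinHodgeI2002, §7.3.1] -/
theorem homClass_app_mem_flatSections (φ : Hom D₁ D₂) : (fun s => D₁.homClass D₂ s (φ.app s)) ∈ (D₁.hom D₂).VZ.flatSections :=
  fun _ _ γ => φ.transport_homClass_app γ

/-- **Rigidity along paths**: two morphisms which agree at `s` agree at every point `t` joined to `s` (`φ_t = γ_* φ_s γ_*⁻¹`).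
[cite: Deligne1970, I.1] [cite: Schmid1973, §2] -/
theorem app_eq_of_app_eq (φ ψ : Hom D₁ D₂) {s t : S} (γ : Path.Homotopic.Quotient s t) (h : φ.app s = ψ.app s) : φ.app t = ψ.app t := by
  rw [← φ.transport_comp_app_comp_transport_symm γ, ← ψ.transport_comp_app_comp_transport_symm γ, h]

/-- Extensionality: a morphism is determined by its lattice maps. [cite: Deligne1970, I.1] -/
theorem ext_of_app (φ ψ : Hom D₁ D₂) (h : ∀ s : S, φ.app s = ψ.app s) : φ = ψ := by
  obtain ⟨fφ, hφ⟩ := φ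
  obtain ⟨fψ, hψ⟩ := ψ
  have hf : fφ = fψ := by
    ext x : 2
    exact ModuleCat.hom_ext (h x.as)
  subst hf
  rfl

/-- **A morphism over a path-connected base is determined by its value at one point.** [cite: Deligne1970, I.1] [cite: Schmid1973, §2] -/
theorem ext_of_app_eq [PathConnectedSpace S] (φ ψ : Hom D₁ D₂) (s : S) (h : φ.app s = ψ.app s) : φ = ψ :=
  ext_of_app φ ψ fun t => app_eq_of_app_eq φ ψ (Path.Homotopic.Quotient.mk (PathConnectedSpace.somePath s t)) h

end Hom

end VHSData

end Literature.AlgebraicGeometry.Motives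

end
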